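import Mathlib
import Summits.Langlands.Langlands.Theorems.CapacityClassicalityHilbertIntegralOverconvergentIsCongruenceKatzSturmAbstract
import Summits.Langlands.Langlands.Theorems.CapacityClassicalityHilbertIntegralOverconvergentIsCongruenceStubMvCoeffMulBound
import Summits.Langlands.Langlands.Theorems.CapacityClassicalityHilbertIntegralOverconvergentIsCongruenceStubMvCoeffInvBound
import Summits.Langlands.Langlands.Theorems.CapacityClassicalityHilbertIntegralOverconvergentIsCongruenceGradedKatzGain

/-!
# Crux `HilbertIntegralOverconvergentIsCongruence` (stmt-Langlands-8485), line `Sketch-ideate-r1-k1`: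
# the `d`-free lever and graded gain, hypothesis-free

Assembly of the landed stubs 13 (`stub_katzSturmAbstract`), 14 (`stub_mvCoeffMulBound`),
15 (`stub_mvCoeffInvBound`) and 18 (`stub_gradedKatzGain`) of the line into the two statements the
Hilbert engine's instantiation consumes with NO residual hypothesis beyond its own data:

* `stub_katzSturmLever` (registered stub 13′) — the `p`-adic Schwarz lemma at the cusp in `MvPowerSeries σ K` over any
  nonarchimedean normed field `K` (stub 13 with the product rule and the integrality of inverses
  discharged by stubs 14, 15);
* `stub_gradedKatzGainFree` (registered stub 18′) — its graded form (stub 18 with the lever discharged): vanishing in weights `< m`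
  and `L (w + M t) ≤ m` give `‖G_n‖ ≤ C ρ^{M+1}`.

Theorems only, no `sorry`.
-/

set_option linter.dupNamespace false

noncomputable section

namespace Summit.Langlands.Langlands.Theorems.HilbertIntegralOverconvergentIsCongruence

open MvPowerSeries in
/-- **The `d`-free Katz–Sturm lever, hypothesis-free.**  `K` a nonarchimedean normed field, `σ` any
set of variables, `V` a set of series with the sup-norm Sturm principle on the window `W`, `e` an
integral series with constant term `1`, `a_i` a Katz datum with `‖(a_i)_n‖ ≤ C ρ^i` (`0 ≤ ρ ≤ 1`,
`0 ≤ C`) whose `M`-th truncation lies in `V`, `G` its Katz sum along `e⁻¹`.  If `G` vanishes on a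
lower set `D ⊇ W` of exponents then `‖G_n‖ ≤ C ρ^{M+1}` for every `n`. [folklore] -/
theorem stub_katzSturmLever {K σ : Type*} [NormedField K] [IsUltrametricDist K]
    (V : Set (MvPowerSeries σ K)) (W : Set (σ →₀ ℕ))
    (hSturm : ∀ T ∈ V, ∀ B : ℝ, 0 ≤ B → (∀ n ∈ W, ‖coeff n T‖ ≤ B) → ∀ n, ‖coeff n T‖ ≤ B)
    (e : MvPowerSeries σ K) (he0 : constantCoeff e = 1) (he : ∀ n, ‖coeff n e‖ ≤ 1)
    (a : ℕ → MvPowerSeries σ K) (ρ C : ℝ) (hρ : 0 ≤ ρ) (hρ1 : ρ ≤ 1) (hC : 0 ≤ C)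
    (ha : ∀ i n, ‖coeff n (a i)‖ ≤ C * ρ ^ i)
    (M : ℕ) (htrunc : (∑ i ∈ Finset.range (M + 1), a i * e ^ (M - i)) ∈ V)
    (G : MvPowerSeries σ K)
    (hG : ∀ n, HasSum (fun i : ℕ ↦ coeff n (a i * e⁻¹ ^ i)) (coeff n G))
    (D : Set (σ →₀ ℕ)) (hD : IsLowerSet D) (hvan : ∀ n ∈ D, coeff n G = 0) (hWD : W ⊆ D) :
    ∀ n, ‖coeff n G‖ ≤ C * ρ ^ (M + 1) :=
  stub_katzSturmAbstract (fun φ ψ A B hA hB hφ hψ ↦ stub_mvCoeffMulBound φ ψ A B hA hB hφ hψ)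
    (fun φ h0 hφ ↦ stub_mvCoeffInvBound φ h0 hφ) V W hSturm e he0 he a ρ C hρ hρ1 hC ha M htrunc G
    hG D hD hvan hWD

open MvPowerSeries in
/-- **The graded gain, hypothesis-free.**  For a graded family `V : ℤ → Set (MvPowerSeries σ K)`
(`1 ∈ V 0`, `V a · V b ⊆ V (a+b)`, each `V a` closed under finite sums) with the sup-norm Sturm
principle on windows `W k` strictly below a Sturm line `L k` for a monotone weight `wt`, an integral
Hasse lift `e ∈ V t` with constant term `1`, and a Katz datum `a_i ∈ V (w + i t)`, `‖(a_i)_n‖ ≤ C ρ^i`,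
summing to `G` along `e⁻¹`: if `G_n = 0` whenever `wt n < m` and `L (w + M t) ≤ m`, then
`‖G_n‖ ≤ C ρ^{M+1}` for every `n`. [folklore] -/
theorem stub_gradedKatzGainFree {K σ : Type*} [NormedField K] [IsUltrametricDist K]
    (V : ℤ → Set (MvPowerSeries σ K)) (hV1 : (1 : MvPowerSeries σ K) ∈ V 0)
    (hVmul : ∀ (b₁ b₂ : ℤ) (φ ψ : MvPowerSeries σ K), φ ∈ V b₁ → ψ ∈ V b₂ → φ * ψ ∈ V (b₁ + b₂))
    (hVsum : ∀ (b : ℤ) (s : Finset ℕ) (φ : ℕ → MvPowerSeries σ K),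
      (∀ i ∈ s, φ i ∈ V b) → (∑ i ∈ s, φ i) ∈ V b)
    (W : ℤ → Set (σ →₀ ℕ))
    (hSturm : ∀ (k : ℤ), ∀ T ∈ V k, ∀ B : ℝ, 0 ≤ B → (∀ n ∈ W k, ‖coeff n T‖ ≤ B) →
      ∀ n, ‖coeff n T‖ ≤ B)
    (wt : (σ →₀ ℕ) → ℕ) (hwt : Monotone wt) (L : ℤ → ℕ) (hWL : ∀ k, ∀ n ∈ W k, wt n < L k)
    (e : MvPowerSeries σ K) (t : ℤ) (he0 : constantCoeff e = 1) (he : ∀ n, ‖coeff n e‖ ≤ 1)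
    (heV : e ∈ V t)
    (a : ℕ → MvPowerSeries σ K) (w : ℤ) (haV : ∀ i : ℕ, a i ∈ V (w + i * t))
    (ρ C : ℝ) (hρ : 0 ≤ ρ) (hρ1 : ρ ≤ 1) (hC : 0 ≤ C) (ha : ∀ i n, ‖coeff n (a i)‖ ≤ C * ρ ^ i)
    (G : MvPowerSeries σ K) (hG : ∀ n, HasSum (fun i : ℕ ↦ coeff n (a i * e⁻¹ ^ i)) (coeff n G))
    (m : ℕ) (hvan : ∀ n, wt n < m → coeff n G = 0) (M : ℕ) (hM : L (w + M * t) ≤ m) :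
    ∀ n, ‖coeff n G‖ ≤ C * ρ ^ (M + 1) :=
  stub_gradedKatzGain
    (fun V' W' hS e' he0' he' a' ρ' C' hρ' hρ1' hC' ha' M' ht' G' hG' D' hD' hv' hWD' ↦
      stub_katzSturmLever V' W' hS e' he0' he' a' ρ' C' hρ' hρ1' hC' ha' M' ht' G' hG' D' hD' hv' hWD')
    V hV1 hVmul hVsum W hSturm wt hwt L hWL e t he0 he heV a w haV ρ C hρ hρ1 hC ha G hG m hvan M hM

end Summit.Langlands.Langlands.Theorems.HilbertIntegralOverconvergentIsCongruence

end
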